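import Literature.Algebra.Polynomial.CasasAlvero.Descent
import Literature.Algebra.Polynomial.CasasAlvero.Scaling
import Literature.Algebra.Polynomial.CasasAlvero.FieldCorollaries
import Literature.Algebra.Polynomial.CasasAlvero.DepressedReduction
import Literature.Algebra.Polynomial.CasasAlvero.SmallDegreesSummary
import Mathlib.Data.Nat.Prime.Int
import Mathlib.Tactic.NormNum.Prime
import Mathlib.RingTheory.Valuation.LocalSubring
import Mathlib.RingTheory.Localization.AtPrime.Basic
import Mathlib.RingTheory.LocalRing.ResidueField.Basic
import Mathlib.FieldTheory.IsAlgClosed.AlgebraicClosure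
import HarnessLib

/-!
# Casas-Alvero: the transfer from characteristic `p` to characteristic `0`
(Graf von Bothmer–Labs–Schicho–van de Woestijne, *The Casas-Alvero conjecture for infinitely many degrees*,
J. Algebra 316 (2007) 224–230, arXiv:math/0605090, Prop. 2 and the Theorem)

`PrimePower.lean` / `Descent.lean` prove the characteristic-`p` half of [GvBLSW 2007]: over every field of
characteristic `p` a monic Casas-Alvero polynomial of degree `p^k` or `2p^k` is a pure power.  This file proves
the TRANSFER PRINCIPLE [GvBLSW 2007, Prop. 2] and hence the theorem of that paper in characteristic `0`:

* `holdsInDegree_of_charP_of_charZero` — if the Casas-Alvero statement `HoldsInDegree F d` holds over EVERY field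
  `F` of some prime characteristic `p`, then `HoldsInDegree K d` holds over every field `K` of characteristic `0`
  (contrapositive `exists_charP_not_holdsInDegree_of_charZero`: a counterexample in characteristic `0` forces one in
  EVERY positive characteristic);
* `holdsInDegree_prime_pow_of_charZero`, `holdsInDegree_two_mul_prime_pow_of_charZero` — **the theorem of
  [GvBLSW 2007]**: the Casas-Alvero conjecture holds in characteristic `0` in every degree `p^k` and `2p^k`
  (`p` prime, `k ≥ 0`); `holdsInDegree_three_mul_prime_pow_of_charZero` (`3p^k`, `p ≥ 5`),
  `holdsInDegree_four_mul_prime_pow_of_charZero` (`4p^k`, `p ∉ {3, 5, 7}`) [CLO 2014, §3];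
* `holdsInDegree_of_lt_twelve_of_charZero`, `holdsInDegree_of_lt_twentyEight_of_charZero` — in particular CA
  holds in characteristic `0` for every `d ≤ 11` and for every `d < 28` other than `12` ([CLO 2014], by computer)
  and the two OPEN degrees `20, 24`.

FORM OF THE HYPOTHESIS.  GvBLSW assume `X_d(𝔽̄_p) = ∅` (CA over ONE algebraically closed field of characteristic
`p`); we assume CA_d over EVERY field of characteristic `p` (same universe as `K`).  The two are equivalent by the
Nullstellensatz for the finite-type `ℤ`-scheme `X_d`, which we do not formalise; all characteristic-`p` theorems of
this directory (`holdsInDegree_prime_pow_field`, `holdsInDegree_two_mul_prime_pow_field`, the `Char…Complete`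
classifications, …) are stated over every field of characteristic `p`, so they feed the transfer as it stands.

PROOF OF THE TRANSFER (a valuation-theoretic rendering of the properness argument of [GvBLSW 2007, Prop. 2],
avoiding weighted projective spaces and resultants).  By descent (`HoldsInDegree.descend`) we may assume `K`
algebraically closed.  Let `f = ∏ (X - θ_j)` be monic Casas-Alvero of degree `d` with two distinct roots
`θ₁ ≠ θ₂`.  By Chevalley's extension theorem (Mathlib's `IsLocalRing.exists_factor_valuationRing` applied to
`ℤ_(p) → K`, which exists because `K` has characteristic `0`) there is a valuation ring `A ⊆ K` in which `p` is
a non-unit, so its residue field `κ` has characteristic `p`.  Translate `θ₁` to `0` (`IsCasasAlvero.taylor`) and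
divide by a root `ρ` of maximal valuation (`IsCasasAlvero.rescale`): the new roots `(θ_j - θ₁)/ρ` all lie in `A`
and contain `0` and `1`.  The polynomial `∏ (X - (θ_j - θ₁)/ρ) ∈ A[X]` is Casas-Alvero over `A` (its witnesses are
roots, hence in `A`, and `A → K` is injective), so its reduction `h̄ ∈ κ[X]` is a monic Casas-Alvero polynomial of
degree `d` over `κ` (Hasse derivatives and shared roots pass along ring maps) with the roots `0` and `1`.  By
hypothesis `h̄ = (X - b)^d`, whence `b = 0` and `b = 1` in the field `κ`: contradiction.
No `sorry`, no new axioms; nothing about characteristic `0` is assumed.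
-/

noncomputable section

open Polynomial

namespace Literature.Algebra.Polynomial.CasasAlvero

universe u

section Auxiliary

variable {R S : Type*} [CommRing R] [CommRing S]

/-- The Casas-Alvero property of a MONIC polynomial passes along any ring map to a nontrivial ring
(the degree is preserved by monicity). [folklore] -/
private theorem IsCasasAlvero.map_of_monic [Nontrivial S] (φ : R →+* S) {f : R[X]} (hf : f.Monic)
    (h : IsCasasAlvero f) : IsCasasAlvero (f.map φ) := by
  intro i hi0 hi
  rw [hf.natDegree_map φ] at hi
  rw [hasseDeriv_map]
  exact (h i hi0 hi).map φ

/-- Taylor shift of a product of linear factors: `∏ (X - θ)` shifted by `r` is `∏ (X - (θ - r))`. [folklore] -/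
private theorem taylor_multiset_prod_X_sub_C (r : R) (s : Multiset R) :
    taylor r (s.map fun θ => X - C θ).prod = (s.map fun θ => X - C (θ - r)).prod := by
  induction s using Multiset.induction_on with
  | empty => simp [taylor_one]
  | cons a s ih =>
      rw [Multiset.map_cons, Multiset.prod_cons, Multiset.map_cons, Multiset.prod_cons, taylor_mul, ih,
        map_sub, taylor_X, taylor_C, map_sub]
      ring

/-- Scaling of a product of linear factors over a field: `∏ (sX - θ) = s^n ∏ (X - θ/s)` (`s ≠ 0`). [folklore] -/
private theorem multiset_prod_X_sub_C_comp_C_mul_X {K : Type*} [Field K] {s : K} (hs : s ≠ 0) (t : Multiset K) :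
    ((t.map fun θ => X - C θ).prod).comp (C s * X) =
      C (s ^ Multiset.card t) * (t.map fun θ => X - C (θ / s)).prod := by
  induction t using Multiset.induction_on with
  | empty => simp
  | cons a t ih =>
      rw [Multiset.map_cons, Multiset.prod_cons, mul_comp, ih, Multiset.card_cons, Multiset.map_cons,
        Multiset.prod_cons, sub_comp, X_comp, C_comp, pow_succ, C_mul]
      have : C s * X - C a = C s * (X - C (a / s)) := by
        rw [mul_sub, ← C_mul, mul_div_cancel₀ _ hs]
      rw [this]; ring

/-- a root of `∏_{θ ∈ t} (X - θ)` over a domain is one of the `θ`. [folklore] -/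
private theorem mem_of_eval_multiset_prod_X_sub_C_eq_zero [IsDomain R] {t : Multiset R} {x : R}
    (hx : ((t.map fun θ => X - C θ).prod).eval x = 0) : x ∈ t := by
  rw [eval_multiset_prod, Multiset.map_map, Multiset.prod_eq_zero_iff, Multiset.mem_map] at hx
  obtain ⟨θ, hθ, h0⟩ := hx
  simp only [Function.comp, eval_sub, eval_X, eval_C] at h0
  rwa [← sub_eq_zero.mp h0] at hθ

/-- every `θ ∈ t` is a root of `∏_{θ ∈ t} (X - θ)`. [folklore] -/
private theorem eval_multiset_prod_X_sub_C_eq_zero_of_mem {t : Multiset R} {x : R} (hx : x ∈ t) :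
    ((t.map fun θ => X - C θ).prod).eval x = 0 := by
  rw [eval_multiset_prod, Multiset.map_map]
  exact Multiset.prod_eq_zero (Multiset.mem_map.mpr ⟨x, hx, by simp⟩)

end Auxiliary

section Chevalley

/-- **Chevalley for `ℤ_(p) ⊂ K`.**  A field of characteristic `0` has, for every prime `p`, a valuation subring
in which `p` is a non-unit (a valuation ring of `K` dominating `ℤ_(p)`; Mathlib's
`IsLocalRing.exists_factor_valuationRing`). [cite: GrafVonBothmerEtAl2007, Prop. 2] -/
theorem exists_valuationSubring_valuation_lt_one (K : Type u) [Field K] [CharZero K] (p : ℕ)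
    [hp : Fact p.Prime] : ∃ A : ValuationSubring K, A.valuation (p : K) < 1 := by
  classical
  let P : Ideal ℤ := Ideal.span {(p : ℤ)}
  haveI hP : P.IsPrime :=
    (Ideal.span_singleton_prime (by exact_mod_cast hp.out.ne_zero)).mpr (Nat.prime_iff_prime_int.mp hp.out)
  have hunit : ∀ s : P.primeCompl, IsUnit (Int.castRingHom K s.1) := by
    intro s
    have hs0 : (s.1 : ℤ) ≠ 0 := fun h0 => s.2 (h0 ▸ P.zero_mem)
    exact Ne.isUnit (by simpa using hs0)
  set ψ : Localization.AtPrime P →+* K := IsLocalization.lift (M := P.primeCompl) hunit with hψ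
  obtain ⟨A, hA, hloc⟩ := IsLocalRing.exists_factor_valuationRing ψ
  refine ⟨A, ?_⟩
  have hpA : (p : K) ∈ A := natCast_mem A p
  rcases A.valuation_lt_one_or_eq_one ⟨p, hpA⟩ with hlt | heq
  · exact hlt
  · exfalso
    have hu : IsUnit (⟨(p : K), hpA⟩ : A) := (A.valuation_eq_one_iff _).mpr heq
    have key : (ψ.codRestrict A.toSubring hA) (algebraMap ℤ (Localization.AtPrime P) (p : ℤ)) =
        ⟨(p : K), hpA⟩ := by
      apply Subtype.ext
      change ψ (algebraMap ℤ (Localization.AtPrime P) (p : ℤ)) = (p : K)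
      rw [hψ, IsLocalization.lift_eq]
      simp
    have hu' : IsUnit (algebraMap ℤ (Localization.AtPrime P) (p : ℤ)) :=
      (isUnit_map_iff (ψ.codRestrict A.toSubring hA) _).mp (by rw [key]; exact hu)
    exact ((IsLocalization.AtPrime.isUnit_to_map_iff (Localization.AtPrime P) P (p : ℤ)).mp hu')
      (Ideal.mem_span_singleton_self (p : ℤ))

/-- In a valuation ring, a nonempty finite family of elements of `K` has a member of maximal valuation, which
then divides all the others inside `A`. [folklore] -/
private theorem exists_mem_forall_div_mem {K : Type u} [Field K] (A : ValuationSubring K) (t : Multiset K) (ht : t ≠ 0) :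
    ∃ ρ ∈ t, ∀ θ ∈ t, A.valuation θ ≤ A.valuation ρ := by
  classical
  obtain ⟨ρ, hρ, hmax⟩ :=
    t.toFinset.exists_max_image (fun x => A.valuation x) (Multiset.toFinset_nonempty.mpr ht)
  exact ⟨ρ, Multiset.mem_toFinset.mp hρ, fun θ hθ => hmax θ (Multiset.mem_toFinset.mpr hθ)⟩

end Chevalley

section Transfer

variable (p : ℕ) [hp : Fact p.Prime]

/-- The transfer over an ALGEBRAICALLY CLOSED field of characteristic `0`: if `CA_d` holds over every field of
characteristic `p` (in the universe of `K`), it holds over `K`. [cite: GrafVonBothmerEtAl2007, Prop. 2] -/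
theorem holdsInDegree_of_charP_of_isAlgClosed {K : Type u} [Field K] [CharZero K] [IsAlgClosed K] {d : ℕ}
    (h : ∀ (F : Type u) [Field F] [CharP F p], HoldsInDegree F d) : HoldsInDegree K d := by
  classical
  intro f hf hfd hca
  -- degree 0
  rcases Nat.eq_zero_or_pos d with rfl | hdpos
  · exact ⟨0, by rw [pow_zero]; exact (Monic.natDegree_eq_zero hf).mp hfd⟩
  -- `f` is the product of `X - θ` over its roots
  set s : Multiset K := f.roots with hs_def
  have hcard : Multiset.card s = d := by rw [hs_def, IsAlgClosed.card_roots_eq_natDegree, hfd]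
  have hprod : (s.map fun a => X - C a).prod = f :=
    prod_multiset_X_sub_C_of_monic_of_roots_card_eq hf (by rw [IsAlgClosed.card_roots_eq_natDegree])
  by_contra hne
  -- two distinct roots
  have h2 : ∃ θ₁ ∈ s, ∃ θ₂ ∈ s, θ₁ ≠ θ₂ := by
    by_contra hall
    push Not at hall
    have hs0 : s ≠ 0 := by
      intro h0; rw [h0, Multiset.card_zero] at hcard; omega
    obtain ⟨θ, hθ⟩ := Multiset.exists_mem_of_ne_zero hs0
    apply hne
    refine ⟨θ, ?_⟩
    have hrep : s = Multiset.replicate d θ :=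
      Multiset.eq_replicate.mpr ⟨hcard, fun b hb => (hall b hb θ hθ)⟩
    rw [← hprod, hrep, Multiset.map_replicate, Multiset.prod_replicate]
  obtain ⟨θ₁, hθ₁, θ₂, hθ₂, h12⟩ := h2
  -- translate `θ₁` to `0`
  set t : Multiset K := s.map fun θ => θ - θ₁ with ht_def
  have hcard_t : Multiset.card t = d := by rw [ht_def, Multiset.card_map, hcard]
  set g : K[X] := (t.map fun θ => X - C θ).prod with hg_def
  have hg_eq : g = taylor θ₁ f := by
    rw [← hprod, taylor_multiset_prod_X_sub_C, hg_def, ht_def, Multiset.map_map]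
    rfl
  have hg_monic : g.Monic := by rw [hg_eq]; exact monic_taylor hf θ₁
  have hg_deg : g.natDegree = d := by rw [hg_eq, natDegree_taylor, hfd]
  have hg_ca : IsCasasAlvero g := by rw [hg_eq]; exact hca.taylor θ₁
  have h0t : (0 : K) ∈ t := Multiset.mem_map.mpr ⟨θ₁, hθ₁, sub_self θ₁⟩
  have hδt : θ₂ - θ₁ ∈ t := Multiset.mem_map.mpr ⟨θ₂, hθ₂, rfl⟩
  have hδ : θ₂ - θ₁ ≠ 0 := sub_ne_zero.mpr (Ne.symm h12)
  -- a valuation ring of `K` in which `p` is a non-unit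
  obtain ⟨A, hAp⟩ := exists_valuationSubring_valuation_lt_one K p
  -- a root `ρ` of maximal valuation
  obtain ⟨ρ, hρt, hρmax⟩ := exists_mem_forall_div_mem A t (fun h0 => by
    rw [h0] at h0t; exact Multiset.notMem_zero _ h0t)
  have hρ : ρ ≠ 0 := by
    intro hρ0
    have hle := hρmax _ hδt
    rw [hρ0, map_zero, le_zero_iff, map_eq_zero] at hle
    exact hδ hle
  -- rescale by `ρ`: the new roots `θ/ρ` all lie in `A`
  set t' : Multiset K := t.map fun θ => θ / ρ with ht'_def
  have hcard_t' : Multiset.card t' = d := by rw [ht'_def, Multiset.card_map, hcard_t]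
  have hmemA : ∀ x ∈ t', x ∈ A := by
    intro x hx
    obtain ⟨θ, hθ, rfl⟩ := Multiset.mem_map.mp hx
    obtain ⟨a, ha⟩ := (A.valuation_le_iff θ ρ).mp (hρmax θ hθ)
    have : θ / ρ = (a : K) := by rw [← ha, mul_div_cancel_right₀ _ hρ]
    rw [this]; exact a.2
  have h0t' : (0 : K) ∈ t' := Multiset.mem_map.mpr ⟨0, h0t, zero_div ρ⟩
  have h1t' : (1 : K) ∈ t' := Multiset.mem_map.mpr ⟨ρ, hρt, div_self hρ⟩
  set hK : K[X] := (t'.map fun θ => X - C θ).prod with hhK_def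
  have hhK_eq : hK = C (ρ ^ g.natDegree)⁻¹ * g.comp (C ρ * X) := by
    rw [hg_def, multiset_prod_X_sub_C_comp_C_mul_X hρ, hcard_t, ← hg_def, hg_deg, ← mul_assoc, ← C_mul,
      inv_mul_cancel₀ (pow_ne_zero _ hρ), C_1, one_mul, hhK_def, ht'_def, Multiset.map_map]
    rfl
  obtain ⟨-, hhK_deg, hhK_ca⟩ := hg_ca.rescale hρ hg_monic
  rw [← hhK_eq, hg_deg] at hhK_deg
  rw [← hhK_eq] at hhK_ca
  -- the polynomial with roots `t'` over `A`
  let lift : K → A := fun x => if hx : x ∈ A then ⟨x, hx⟩ else 0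
  have hlift : ∀ x ∈ t', ((lift x : A) : K) = x := by
    intro x hx; simp only [lift, dif_pos (hmemA x hx)]
  set u : Multiset A := t'.map lift with hu_def
  set hA : A[X] := (u.map fun a => X - C a).prod with hhA_def
  have hmap : hA.map (algebraMap A K) = hK := by
    rw [hhA_def, Polynomial.map_multiset_prod, Multiset.map_map, hu_def, Multiset.map_map, hhK_def]
    apply congrArg
    apply Multiset.map_congr rfl
    intro x hx
    simp only [Function.comp, Polynomial.map_sub, map_X, map_C, ValuationSubring.algebraMap_apply, hlift x hx]
  have hinj : Function.Injective (algebraMap A K) := fun a b hab => Subtype.ext hab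
  have hhA_monic : hA.Monic :=
    monic_multiset_prod_of_monic _ _ fun a _ => monic_X_sub_C a
  have hhA_deg : hA.natDegree = d := by
    rw [hhA_def, natDegree_multiset_prod_X_sub_C_eq_card, hu_def, Multiset.card_map, hcard_t']
  have hhA_ca : IsCasasAlvero hA := by
    intro i hi0 hi
    rw [hhA_deg, ← hhK_deg] at hi
    obtain ⟨θ, hθf, hθH⟩ := hhK_ca i hi0 hi
    have hθt' : θ ∈ t' := mem_of_eval_multiset_prod_X_sub_C_eq_zero (by rw [← hhK_def]; exact hθf)
    have hθA : θ ∈ A := hmemA θ hθt'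
    refine ⟨⟨θ, hθA⟩, ?_, ?_⟩
    · apply hinj
      rw [map_zero, ← eval₂_hom, ← eval_map, hmap]
      exact hθf
    · apply hinj
      rw [map_zero, ← eval₂_hom, ← eval_map, ← hasseDeriv_map, hmap]
      exact hθH
  -- reduce to the residue field `κ` of `A`, which has characteristic `p`
  let κ := IsLocalRing.ResidueField A
  let π : A →+* κ := IsLocalRing.residue A
  haveI : CharP κ p := by
    refine (CharP.charP_iff_prime_eq_zero hp.out).mpr ?_
    have hpmax : ((p : ℕ) : A) ∈ IsLocalRing.maximalIdeal A := by
      rw [A.valuation_lt_one_iff]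
      have : (((p : ℕ) : A) : K) = (p : K) := map_natCast A.subtype p
      rw [this]; exact hAp
    rw [← map_natCast π p]
    exact (IsLocalRing.residue_eq_zero_iff _).mpr hpmax
  set hbar : κ[X] := hA.map π with hhbar_def
  have hbar_monic : hbar.Monic := hhA_monic.map π
  have hbar_deg : hbar.natDegree = d := by rw [hhbar_def, hhA_monic.natDegree_map π, hhA_deg]
  have hbar_ca : IsCasasAlvero hbar := hhA_ca.map_of_monic π hhA_monic
  have hbar_eq : hbar = ((u.map π).map fun b => X - C b).prod := by
    simp only [hhbar_def, hhA_def, hu_def, Polynomial.map_multiset_prod, Multiset.map_map, Function.comp_def,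
      Polynomial.map_sub, map_X, map_C]
  -- `0` and `1` are roots of `hbar`
  have hroot : ∀ x : K, ∀ hx : x ∈ t', hbar.eval (π (lift x)) = 0 := by
    intro x hx
    rw [hbar_eq]
    exact eval_multiset_prod_X_sub_C_eq_zero_of_mem
      (Multiset.mem_map.mpr ⟨lift x, Multiset.mem_map.mpr ⟨x, hx, rfl⟩, rfl⟩)
  have hlift0 : lift 0 = 0 := Subtype.ext (by rw [hlift 0 h0t']; rfl)
  have hlift1 : lift 1 = 1 := Subtype.ext (by rw [hlift 1 h1t']; rfl)
  have hr0 : hbar.eval 0 = 0 := by simpa [hlift0] using hroot 0 h0t'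
  have hr1 : hbar.eval 1 = 0 := by simpa [hlift1] using hroot 1 h1t'
  -- the hypothesis in characteristic `p`
  obtain ⟨b, hb⟩ := h κ hbar hbar_monic hbar_deg hbar_ca
  rw [hb, eval_pow, eval_sub, eval_X, eval_C] at hr0 hr1
  have hb0 : b = 0 := by
    have := (pow_eq_zero_iff hdpos.ne').mp hr0
    rwa [zero_sub, neg_eq_zero] at this
  have hb1 : b = 1 := by
    have := (pow_eq_zero_iff hdpos.ne').mp hr1
    exact (sub_eq_zero.mp this).symm
  exact one_ne_zero (hb1.symm.trans hb0)

/-- **Transfer principle** [GvBLSW 2007, Prop. 2] in the form: if the Casas-Alvero statement holds in degree `d`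
over EVERY field of some prime characteristic `p`, then it holds in degree `d` over every field of characteristic
`0`.  (GvBLSW state the hypothesis as `X_d(𝔽̄_p) = ∅`, i.e. `CA_d` over one algebraic closure of `𝔽_p`; that this
already gives `CA_d` over every field of characteristic `p` is Hilbert's Nullstellensatz for the scheme `X_d` and is
NOT formalised here — every characteristic-`p` result of this directory is proved over all fields of characteristic
`p`, which is the hypothesis used below.  Their additional conclusion "and in characteristic `ℓ` for all but
finitely many primes `ℓ`" is not formalised either.) [cite: GrafVonBothmerEtAl2007, Prop. 2] -/
theorem holdsInDegree_of_charP_of_charZero {d : ℕ} (h : ∀ (F : Type u) [Field F] [CharP F p], HoldsInDegree F d)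
    (K : Type u) [Field K] [CharZero K] : HoldsInDegree K d :=
  HoldsInDegree.descend (algebraMap K (AlgebraicClosure K))
    (holdsInDegree_of_charP_of_isAlgClosed (K := AlgebraicClosure K) p h)

/-- Contrapositive form: a failure of `CA_d` over a field of characteristic `0` forces, for EVERY prime `p`, a
failure over some field of characteristic `p` ("no good prime"). [cite: GrafVonBothmerEtAl2007, Prop. 2] -/
theorem exists_charP_not_holdsInDegree_of_charZero {K : Type u} [Field K] [CharZero K] {d : ℕ}
    (hK : ¬ HoldsInDegree K d) :
    ∃ (F : Type u) (_ : Field F) (_ : CharP F p), ¬ HoldsInDegree F d := by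
  by_contra hall
  push Not at hall
  exact hK (holdsInDegree_of_charP_of_charZero p (fun F _ _ => hall F inferInstance inferInstance) K)

end Transfer

section Consequences

variable (K : Type u) [Field K] [CharZero K]

/-- **[GvBLSW 2007, Theorem] in degree `p^k`**: over a field of characteristic `0`, a monic Casas-Alvero polynomial
of prime-power degree `p^k` is `(X - a)^(p^k)`. [cite: GrafVonBothmerEtAl2007, Thm. 1] -/
theorem holdsInDegree_prime_pow_of_charZero (p : ℕ) [Fact p.Prime] (k : ℕ) : HoldsInDegree K (p ^ k) :=
  holdsInDegree_of_charP_of_charZero p (fun F _ _ => holdsInDegree_prime_pow_field F p k) K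

/-- **[GvBLSW 2007, Theorem] in degree `2p^k`**: over a field of characteristic `0`, a monic Casas-Alvero
polynomial of degree `2p^k` is `(X - a)^(2p^k)`. [cite: GrafVonBothmerEtAl2007, Thm. 1] -/
theorem holdsInDegree_two_mul_prime_pow_of_charZero (p : ℕ) [Fact p.Prime] (k : ℕ) :
    HoldsInDegree K (2 * p ^ k) :=
  holdsInDegree_of_charP_of_charZero p (fun F _ _ => holdsInDegree_two_mul_prime_pow_field F p k) K

/-- Degree `3p^k`, `p ≥ 5`, in characteristic `0` (the primes `2, 3` are the bad primes of degree `3`).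
[cite: CastryckLaterveerOunaies2012, Thm. 4] -/
theorem holdsInDegree_three_mul_prime_pow_of_charZero (p : ℕ) [Fact p.Prime] (hp5 : 5 ≤ p) (k : ℕ) :
    HoldsInDegree K (3 * p ^ k) :=
  holdsInDegree_of_charP_of_charZero p (fun F _ _ => holdsInDegree_three_mul_prime_pow_field F p hp5 k) K

/-- Degree `4p^k`, `p ≥ 11`, in characteristic `0` (the bad primes of degree `4` are `3, 5, 7`; `p = 2` is the
prime-power case `2^(k+2)`). [cite: CastryckLaterveerOunaies2012, Thm. 4] -/
theorem holdsInDegree_four_mul_prime_pow_of_charZero (p : ℕ) [Fact p.Prime] (hp11 : 11 ≤ p) (k : ℕ) :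
    HoldsInDegree K (4 * p ^ k) :=
  holdsInDegree_of_charP_of_charZero p
    (fun F _ _ => holdsInDegree_mul_prime_pow_field F p
      (holdsInDegree_of_le_four_of_charP (AlgebraicClosure F) p hp11 le_rfl) k) K

/-- **The Casas-Alvero conjecture in characteristic `0` for every degree `d ≤ 11`** (`d = 1, 2, 3, 4, 5, 7, 8, 9, 11`
are prime powers, `6 = 2·3`, `10 = 2·5`). [cite: GrafVonBothmerEtAl2007, Thm. 1] -/
theorem holdsInDegree_of_lt_twelve_of_charZero {d : ℕ} (hd : d < 12) : HoldsInDegree K d := by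
  haveI h2 : Fact (Nat.Prime 2) := ⟨Nat.prime_two⟩
  haveI h3 : Fact (Nat.Prime 3) := ⟨Nat.prime_three⟩
  haveI h5 : Fact (Nat.Prime 5) := ⟨by norm_num⟩
  haveI h7 : Fact (Nat.Prime 7) := ⟨by norm_num⟩
  haveI h11 : Fact (Nat.Prime 11) := ⟨by norm_num⟩
  interval_cases d
  · exact holdsInDegree_zero K
  · simpa using holdsInDegree_prime_pow_of_charZero K 2 0
  · simpa using holdsInDegree_prime_pow_of_charZero K 2 1
  · simpa using holdsInDegree_prime_pow_of_charZero K 3 1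
  · simpa using holdsInDegree_prime_pow_of_charZero K 2 2
  · simpa using holdsInDegree_prime_pow_of_charZero K 5 1
  · simpa using holdsInDegree_two_mul_prime_pow_of_charZero K 3 1
  · simpa using holdsInDegree_prime_pow_of_charZero K 7 1
  · simpa using holdsInDegree_prime_pow_of_charZero K 2 3
  · simpa using holdsInDegree_prime_pow_of_charZero K 3 2
  · simpa using holdsInDegree_two_mul_prime_pow_of_charZero K 5 1
  · simpa using holdsInDegree_prime_pow_of_charZero K 11 1

/-- **Characteristic `0`, every degree `d < 28` other than `12, 20, 24`.**  The degrees `13, 16, 17, 19, 23, 25, 27` are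
prime powers, `14 = 2·7`, `18 = 2·9`, `22 = 2·11`, `26 = 2·13`, `15 = 3·5`, `21 = 3·7`; `d = 12` is [CLO 2014, Thm. 5]
(a machine computation not reproduced in this tree) and `d = 20, 24` are OPEN (the two smallest open cases of the
conjecture). [cite: GrafVonBothmerEtAl2007, Thm. 1] [cite: CastryckLaterveerOunaies2012, Thm. 4] -/
theorem holdsInDegree_of_lt_twentyEight_of_charZero {d : ℕ} (hd : d < 28) (h12 : d ≠ 12) (h20 : d ≠ 20)
    (h24 : d ≠ 24) : HoldsInDegree K d := by
  rcases Nat.lt_or_ge d 12 with h | h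
  · exact holdsInDegree_of_lt_twelve_of_charZero K h
  haveI h2 : Fact (Nat.Prime 2) := ⟨Nat.prime_two⟩
  haveI h3 : Fact (Nat.Prime 3) := ⟨Nat.prime_three⟩
  haveI h5 : Fact (Nat.Prime 5) := ⟨by norm_num⟩
  haveI h7 : Fact (Nat.Prime 7) := ⟨by norm_num⟩
  haveI h11 : Fact (Nat.Prime 11) := ⟨by norm_num⟩
  haveI h13 : Fact (Nat.Prime 13) := ⟨by norm_num⟩
  haveI h17 : Fact (Nat.Prime 17) := ⟨by norm_num⟩
  haveI h19 : Fact (Nat.Prime 19) := ⟨by norm_num⟩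
  haveI h23 : Fact (Nat.Prime 23) := ⟨by norm_num⟩
  interval_cases d
  · exact absurd rfl h12
  · simpa using holdsInDegree_prime_pow_of_charZero K 13 1
  · simpa using holdsInDegree_two_mul_prime_pow_of_charZero K 7 1
  · simpa using holdsInDegree_three_mul_prime_pow_of_charZero K 5 le_rfl 1
  · simpa using holdsInDegree_prime_pow_of_charZero K 2 4
  · simpa using holdsInDegree_prime_pow_of_charZero K 17 1
  · simpa using holdsInDegree_two_mul_prime_pow_of_charZero K 3 2
  · simpa using holdsInDegree_prime_pow_of_charZero K 19 1
  · exact absurd rfl h20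
  · simpa using holdsInDegree_three_mul_prime_pow_of_charZero K 7 (by norm_num) 1
  · simpa using holdsInDegree_two_mul_prime_pow_of_charZero K 11 1
  · simpa using holdsInDegree_prime_pow_of_charZero K 23 1
  · exact absurd rfl h24
  · simpa using holdsInDegree_prime_pow_of_charZero K 5 2
  · simpa using holdsInDegree_two_mul_prime_pow_of_charZero K 13 1
  · simpa using holdsInDegree_prime_pow_of_charZero K 3 3

end Consequences

end Literature.Algebra.Polynomial.CasasAlvero
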